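import Summits.Ventures.Crystal3D.Theorems.StickyWulffConstantGenericWallFloorTubeWalkSF
import HarnessLib

/-!
# The tube walk for CHAIN pairs: it pays or it ends at a tilted terminal twin dozen

HONEST FRAMING. Venture `Summits/Ventures/Crystal3D` (cell `crystal3d-full`), helper for the crux
`GenericWallFloor` (stmt-Ventures-19480) of `route-Ventures-StickyWulffConstant`, REGISTERED line `WallLedgerG`,
open stub `stub_twoSlabAdhesion` (general fillings; ARCH v4 «coherent walks in tubes» extended to the `Σ3ⁿ`
chain pairs).  Rung credit only; F-C1 not moved.

`tube_walk_chain_sf` is `tube_walk_pays_sf` (…TubeWalkSF) with the non-chain hypothesis REMOVED.  Instead of a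
mirror-closed frame set avoiding `A₂(Λ₀)` it takes a set `𝓣` of TERMINAL frames containing every frame `G`
with `G(Λ₀) = A₂(Λ₀)` (hypothesis `hT`), and runs the steered coherent walk only through frames OUTSIDE `𝓣`.
Conclusion: either (a) as before, a ball with at most eleven contacts within horizontal distance `18` of the
axis at a controlled height, or (b) a TERMINAL TWIN DOZEN in the tube: a ball `e ∈ X` carrying a twin dozen
(own nine slots occupied, far three empty) for a frame `G ∉ 𝓣` and a unit menu normal `n` whose mirror frame
`x ↦ G x − 2⟪G x, n⟫ n` lies IN `𝓣`, within horizontal distance `17` of the axis, at height in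
`[y₂, h + R₀ + 2)`.  (For the class `𝓣` = «`A₂(Λ₀)` or its horizontal twin», closed under horizontal menu
mirrors, the normal in (b) is tilted and `…PlateClimb` turns `e` into a payer; next files.)  Proof: the
induction of `tube_walk_pays_sf` verbatim, with the invariant `F ∉ 𝓣`; a state with frame outside `𝓣` is
never deep in the top window by `movedFcc_eq_of_exact_neighbours_top_sf` + `hT`; at a mirror move into `𝓣`
the walk stops and reports (b).
WHAT THIS IS NOT: not the stub; no counting; F-C1 not moved.
-/

noncomputable section

namespace Summit.Ventures.Crystal3D.Theorems

open Summit.Ventures.Crystal3D Finset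
open Literature.MathematicalPhysics.StatisticalMechanics (fccStacking)
open scoped InnerProductSpace

set_option maxHeartbeats 400000 in
/-- **The tube walk for chain pairs.**  See the module docstring. -/
theorem tube_walk_chain_sf {δ : ℝ} (hg : KissingGap δ) (hc : KissingClassification δ)
    (X : Finset (EuclideanSpace ℝ (Fin 3))) (hX : ∀ p ∈ X, ∀ q ∈ X, p ≠ q → 1 ≤ dist p q)
    (A₂ : EuclideanSpace ℝ (Fin 3) ≃ₗᵢ[ℝ] EuclideanSpace ℝ (Fin 3)) (t₂ : EuclideanSpace ℝ (Fin 3))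
    (P₂ : Finset (EuclideanSpace ℝ (Fin 3))) (R₀ h ρ : ℝ) (hR₀ : 3 ≤ R₀) (hρ : R₀ ≤ ρ) (hρ20 : 20 ≤ ρ)
    (hP₂X : P₂ ⊆ X) (hcell : ∀ p ∈ X, p 2 ≤ h + 2 * R₀)
    (hP₂ : ∀ p, p ∈ P₂ ↔ (p ∈ (fun q => A₂ q + t₂) '' fccStacking 1 (Real.sqrt (2 / 3)) ∧
      h + R₀ ≤ p 2 ∧ p 2 ≤ h + 2 * R₀ ∧ p 0 ^ 2 + p 1 ^ 2 ≤ ρ ^ 2))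
    (𝓣 : Set (EuclideanSpace ℝ (Fin 3) ≃ₗᵢ[ℝ] EuclideanSpace ℝ (Fin 3)))
    (hT : ∀ G : EuclideanSpace ℝ (Fin 3) ≃ₗᵢ[ℝ] EuclideanSpace ℝ (Fin 3),
      G '' fccStacking 1 (Real.sqrt (2 / 3)) = A₂ '' fccStacking 1 (Real.sqrt (2 / 3)) → G ∈ 𝓣)
    (p0 p1 : ℝ) (hp : p0 ^ 2 + p1 ^ 2 ≤ (ρ - 20) ^ 2) :
    ∀ (k : ℕ) (y : EuclideanSpace ℝ (Fin 3)) (F : EuclideanSpace ℝ (Fin 3) ≃ₗᵢ[ℝ] EuclideanSpace ℝ (Fin 3))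
      (a b c : EuclideanSpace ℝ (Fin 3)), y ∈ X → F ∉ 𝓣 → a ∈ fccSlots → b ∈ fccSlots → c ∈ fccSlots →
      LinearIndependent ℝ ![a, b, c] → y + F a ∈ X → y + F b ∈ X → y + F c ∈ X →
      (y 0 - p0) ^ 2 + (y 1 - p1) ^ 2 ≤ 17 ^ 2 → y 2 < h + R₀ + 2 → (h + 2 * R₀ + 2 - y 2) * 32 ≤ k →
      (∃ z ∈ X, (X.filter fun q => dist z q = 1).card ≤ 11 ∧ (z 0 - p0) ^ 2 + (z 1 - p1) ^ 2 ≤ 18 ^ 2 ∧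
        y 2 - 1 ≤ z 2 ∧ z 2 ≤ h + R₀ + 3) ∨
      (∃ e ∈ X, ∃ G : EuclideanSpace ℝ (Fin 3) ≃ₗᵢ[ℝ] EuclideanSpace ℝ (Fin 3), G ∉ 𝓣 ∧
        ∃ n : EuclideanSpace ℝ (Fin 3), ‖n‖ = 1 ∧
        (∀ w ∈ fccSlots, ⟪G w, n⟫_ℝ = 0 ∨ ⟪G w, n⟫_ℝ = Real.sqrt (2 / 3) ∨ ⟪G w, n⟫_ℝ = -Real.sqrt (2 / 3)) ∧
        (∃ G' ∈ 𝓣, ∀ x, G' x = G x - (2 * ⟪G x, n⟫_ℝ) • n) ∧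
        (∀ w ∈ fccSlots, ⟪G w, n⟫_ℝ ≤ 0 → e + G w ∈ X) ∧
        (∀ w ∈ fccSlots, 0 < ⟪G w, n⟫_ℝ → e + G w ∉ X) ∧
        (e 0 - p0) ^ 2 + (e 1 - p1) ^ 2 ≤ 17 ^ 2 ∧ y 2 ≤ e 2 ∧ e 2 < h + R₀ + 2) := by
  set e₃ : EuclideanSpace ℝ (Fin 3) := EuclideanSpace.single (2 : Fin 3) (1 : ℝ) with he₃
  have he₃n : ‖e₃‖ = 1 := by rw [he₃, PiLp.norm_single, norm_one]
  have he₃i : ∀ d : EuclideanSpace ℝ (Fin 3), ⟪d, e₃⟫_ℝ = d 2 := fun d => by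
    rw [he₃, EuclideanSpace.inner_single_right]; simp
  -- the paying conclusion from a payer near the walker
  have hheight : ∀ y z : EuclideanSpace ℝ (Fin 3), dist y z ≤ 1 → y 2 - 1 ≤ z 2 ∧ z 2 ≤ y 2 + 1 := by
    intro y z hd
    have h := abs_apply_sub_le_dist z y 2
    rw [dist_comm] at h
    obtain ⟨h1, h2⟩ := abs_le.1 (h.trans hd)
    exact ⟨by linarith, by linarith⟩
  have conclude : ∀ y z : EuclideanSpace ℝ (Fin 3), (y 0 - p0) ^ 2 + (y 1 - p1) ^ 2 ≤ 17 ^ 2 → dist y z ≤ 1 →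
      (z 0 - p0) ^ 2 + (z 1 - p1) ^ 2 ≤ 18 ^ 2 := by
    intro y z hy hd
    have hn := norm_sq_eq_fin3 (z - y)
    have hd' : ‖z - y‖ ^ 2 ≤ 1 := by
      rw [← dist_eq_norm, dist_comm]; nlinarith [dist_nonneg (x := y) (y := z)]
    have hw : (z - y) 0 ^ 2 + (z - y) 1 ^ 2 ≤ 1 ^ 2 := by nlinarith [sq_nonneg ((z - y) 2)]
    have := sq2_add_le (by norm_num : (0 : ℝ) ≤ 17) (by norm_num : (0 : ℝ) ≤ 1) hy hw
    simp only [PiLp.sub_apply] at this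
    have e0 : z 0 - p0 = (y 0 - p0) + (z 0 - y 0) := by ring
    have e1 : z 1 - p1 = (y 1 - p1) + (z 1 - y 1) := by ring
    rw [e0, e1]; linarith
  -- the steering vector `q`
  have hq : ∀ y : EuclideanSpace ℝ (Fin 3), ∃ q : EuclideanSpace ℝ (Fin 3), ‖q‖ = 1 ∧ ⟪e₃, q⟫_ℝ = 0 ∧
      ∀ d : EuclideanSpace ℝ (Fin 3), (1 / 32 : ℝ) ≤ ⟪d, q⟫_ℝ →
        ((16 : ℝ) ^ 2 ≤ (y 0 - p0) ^ 2 + (y 1 - p1) ^ 2 → 1 / 2 ≤ (p0 - y 0) * d 0 + (p1 - y 1) * d 1) := by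
    intro y
    by_cases hs : (16 : ℝ) ^ 2 ≤ (y 0 - p0) ^ 2 + (y 1 - p1) ^ 2
    · set V : EuclideanSpace ℝ (Fin 3) := EuclideanSpace.single (0 : Fin 3) (p0 - y 0) +
        EuclideanSpace.single (1 : Fin 3) (p1 - y 1) with hV
      have hVi : ∀ d : EuclideanSpace ℝ (Fin 3), ⟪d, V⟫_ℝ = (p0 - y 0) * d 0 + (p1 - y 1) * d 1 := by
        intro d; rw [hV, inner_add_right, EuclideanSpace.inner_single_right, EuclideanSpace.inner_single_right]
        simp
      have hV0 : V 0 = p0 - y 0 := by simp [hV]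
      have hV1 : V 1 = p1 - y 1 := by simp [hV]
      have hVn2 : ‖V‖ ^ 2 = (y 0 - p0) ^ 2 + (y 1 - p1) ^ 2 := by
        rw [← real_inner_self_eq_norm_sq, hVi, hV0, hV1]; ring
      have hVn : 16 ≤ ‖V‖ := by nlinarith [norm_nonneg V]
      have hVpos : 0 < ‖V‖ := by linarith
      refine ⟨(1 / ‖V‖) • V, ?_, ?_, ?_⟩
      · rw [norm_smul, norm_div, norm_one, Real.norm_eq_abs, abs_of_pos hVpos]
        exact one_div_mul_cancel hVpos.ne'
      · rw [inner_smul_right, hVi]; simp [he₃]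
      · intro d hdq _
        rw [inner_smul_right, hVi] at hdq
        have : ‖V‖ / 32 ≤ (p0 - y 0) * d 0 + (p1 - y 1) * d 1 := by
          have h' := mul_le_mul_of_nonneg_left hdq hVpos.le
          rw [← mul_assoc, mul_one_div_cancel hVpos.ne', one_mul] at h'
          linarith
        linarith
    · refine ⟨EuclideanSpace.single (0 : Fin 3) (1 : ℝ), by rw [PiLp.norm_single, norm_one], ?_,
        fun d _ hs' => absurd hs' hs⟩
      simp [he₃, EuclideanSpace.inner_single_left]
  intro k
  induction k with
  | zero =>
    intro y F a b c hy _ _ _ _ _ _ _ _ _ _ hbud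
    have := hcell y hy
    simp only [Nat.cast_zero] at hbud
    linarith
  | succ k ih =>
    intro y F a b c hy hF ha hb hc' hind haX hbX hcX htube hytop hbud
    -- common continuation: a move `d` with `y + d ∈ X`, a state there with frame `G ∉ 𝓣`, rise and steering
    have cont : ∀ (d : EuclideanSpace ℝ (Fin 3)) (G : EuclideanSpace ℝ (Fin 3) ≃ₗᵢ[ℝ] EuclideanSpace ℝ (Fin 3)),
        ‖d‖ = 1 → y + d ∈ X → G ∉ 𝓣 →
        (∃ a' ∈ fccSlots, ∃ b' ∈ fccSlots, ∃ c' ∈ fccSlots, LinearIndependent ℝ ![a', b', c'] ∧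
          y + d + G a' ∈ X ∧ y + d + G b' ∈ X ∧ y + d + G c' ∈ X) →
        (1 / 32 : ℝ) ≤ ⟪d, e₃⟫_ℝ →
        ((16 : ℝ) ^ 2 ≤ (y 0 - p0) ^ 2 + (y 1 - p1) ^ 2 → 1 / 2 ≤ (p0 - y 0) * d 0 + (p1 - y 1) * d 1) →
        (∃ z ∈ X, (X.filter fun q => dist z q = 1).card ≤ 11 ∧ (z 0 - p0) ^ 2 + (z 1 - p1) ^ 2 ≤ 18 ^ 2 ∧
          y 2 - 1 ≤ z 2 ∧ z 2 ≤ h + R₀ + 3) ∨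
        (∃ e ∈ X, ∃ G : EuclideanSpace ℝ (Fin 3) ≃ₗᵢ[ℝ] EuclideanSpace ℝ (Fin 3), G ∉ 𝓣 ∧
          ∃ n : EuclideanSpace ℝ (Fin 3), ‖n‖ = 1 ∧
          (∀ w ∈ fccSlots, ⟪G w, n⟫_ℝ = 0 ∨ ⟪G w, n⟫_ℝ = Real.sqrt (2 / 3) ∨ ⟪G w, n⟫_ℝ = -Real.sqrt (2 / 3)) ∧
          (∃ G' ∈ 𝓣, ∀ x, G' x = G x - (2 * ⟪G x, n⟫_ℝ) • n) ∧
          (∀ w ∈ fccSlots, ⟪G w, n⟫_ℝ ≤ 0 → e + G w ∈ X) ∧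
          (∀ w ∈ fccSlots, 0 < ⟪G w, n⟫_ℝ → e + G w ∉ X) ∧
          (e 0 - p0) ^ 2 + (e 1 - p1) ^ 2 ≤ 17 ^ 2 ∧ y 2 ≤ e 2 ∧ e 2 < h + R₀ + 2) := by
      intro d G hd1 hyd hG hst hrise hsteer
      obtain ⟨a', ha', b', hb', c', hc'', hind', h1, h2, h3⟩ := hst
      rw [he₃i] at hrise
      have hdn := norm_sq_eq_fin3 d
      rw [hd1, one_pow] at hdn
      have hdh : d 0 ^ 2 + d 1 ^ 2 ≤ 1 := by nlinarith [sq_nonneg (d 2)]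
      have htube' : ((y + d) 0 - p0) ^ 2 + ((y + d) 1 - p1) ^ 2 ≤ 17 ^ 2 := by
        simp only [PiLp.add_apply]
        exact horiz_step_le htube hdh hsteer
      -- the new ball is not deep in the top window
      have hy'2 : (y + d) 2 < h + R₀ + 2 := by
        by_contra hge
        push Not at hge
        have hlat : (y + d) 0 ^ 2 + (y + d) 1 ^ 2 ≤ (ρ - 2) ^ 2 := by
          have := sq2_add_le (by linarith : (0 : ℝ) ≤ ρ - 20) (by norm_num : (0 : ℝ) ≤ 17) hp
            (show ((y + d) 0 - p0) ^ 2 + ((y + d) 1 - p1) ^ 2 ≤ 17 ^ 2 from htube')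
          have e0 : (y + d) 0 = p0 + ((y + d) 0 - p0) := by ring
          have e1 : (y + d) 1 = p1 + ((y + d) 1 - p1) := by ring
          rw [e0, e1]; nlinarith
        exact hG (hT G (movedFcc_eq_of_exact_neighbours_top_sf A₂ t₂ X P₂ R₀ h ρ hR₀ hρ hX hP₂X hcell hP₂ G hyd
          hge hlat ha' hb' hc'' hind' h1 h2 h3))
      have hy'd : (y + d) 2 = y 2 + d 2 := by simp only [PiLp.add_apply]
      have hbud' : (h + 2 * R₀ + 2 - (y + d) 2) * 32 ≤ (k : ℝ) := by
        rw [hy'd]; push_cast at hbud ⊢; linarith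
      rcases ih (y + d) G a' b' c' hyd hG ha' hb' hc'' hind' h1 h2 h3 htube' hy'2 hbud' with
        ⟨z, hz, hdeg, hzh, hz1, hz2⟩ | ⟨e, he, G₁, hG₁, n, hn, hmenu, hG', hown, hfar, her, he1, he2⟩
      · exact Or.inl ⟨z, hz, hdeg, hzh, by rw [hy'd] at hz1; linarith, hz2⟩
      · exact Or.inr ⟨e, he, G₁, hG₁, n, hn, hmenu, hG', hown, hfar, her, by rw [hy'd] at he1; linarith, he2⟩
    rcases walk_moves hg hc hX hy F ha hb hc' hind haX hbX hcX with ⟨z, hz, hdist, hdeg⟩ | hfcc | htwin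
    · exact Or.inl ⟨z, hz, hdeg, conclude y z htube hdist, (hheight y z hdist).1,
        by linarith [(hheight y z hdist).2]⟩
    · obtain ⟨q, hq1, hq0, hqst⟩ := hq y
      obtain ⟨w, hw, hwz, hwq⟩ := exists_steering_slot F he₃n hq1 hq0
      obtain ⟨hyw, hst⟩ := hfcc w hw
      have hw1 : ‖F w‖ = 1 := by rw [LinearIsometryEquiv.norm_map, norm_eq_one_of_mem_fccSlots hw]
      exact cont (F w) F hw1 hyw hF hst hwz (hqst _ hwq)
    · obtain ⟨nn, hn, hmenu, F', hF', hown, hmir, hfar⟩ := htwin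
      by_cases hF'T : F' ∈ 𝓣
      · -- the terminal twin dozen: report it
        exact Or.inr ⟨y, hy, F, hF, nn, hn, hmenu, ⟨F', hF'T, hF'⟩, fun w hw hle => (hown w hw hle).1, hfar,
          htube, le_rfl, hytop⟩
      · obtain ⟨q, hq1, hq0, hqst⟩ := hq y
        rcases exists_steering_twinDozen F hn he₃n hq1 hq0 hmenu with ⟨w, hw, hle, hwz, hwq⟩ | ⟨w, hw, hlt, hwz, hwq⟩
        · obtain ⟨hyw, hst⟩ := hown w hw hle
          have hw1 : ‖F w‖ = 1 := by rw [LinearIsometryEquiv.norm_map, norm_eq_one_of_mem_fccSlots hw]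
          exact cont (F w) F hw1 hyw hF hst hwz (hqst _ hwq)
        · obtain ⟨hyw, hst⟩ := hmir w hw hlt
          have hw1 : ‖F' w‖ = 1 := by rw [LinearIsometryEquiv.norm_map, norm_eq_one_of_mem_fccSlots hw]
          have e : F w - (2 * ⟪F w, nn⟫_ℝ) • nn = F' w := (hF' w).symm
          rw [e] at hwz hwq
          exact cont (F' w) F' hw1 hyw hF'T hst hwz (hqst _ hwq)

/-- **Every tube pays or ends at a terminal twin dozen** (the chain-pair version of `tube_has_payer_sf`):
bottom window `P₁` complete on `Λ₁ = A₁·Λ₀ + t₁` at heights `[−2R₀, −R₀]`, top window `P₂` complete on `Λ₂`,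
`A₁ ∉ 𝓣`; for every vertical axis with `p₀² + p₁² ≤ (ρ − 20)²` either a ball with at most eleven contacts lies
within horizontal distance `18` of the axis at height in `[−R₀ − 2, h + R₀ + 3]`, or a terminal twin dozen (as in
`tube_walk_chain_sf`) lies within horizontal distance `17` at height in `[−R₀ − 1, h + R₀ + 2)`. -/
theorem tube_chain_sf {δ : ℝ} (hg : KissingGap δ) (hc : KissingClassification δ)
    (X : Finset (EuclideanSpace ℝ (Fin 3))) (hX : ∀ p ∈ X, ∀ q ∈ X, p ≠ q → 1 ≤ dist p q)
    (A₁ : EuclideanSpace ℝ (Fin 3) ≃ₗᵢ[ℝ] EuclideanSpace ℝ (Fin 3)) (t₁ : EuclideanSpace ℝ (Fin 3))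
    (A₂ : EuclideanSpace ℝ (Fin 3) ≃ₗᵢ[ℝ] EuclideanSpace ℝ (Fin 3)) (t₂ : EuclideanSpace ℝ (Fin 3))
    (P₁ P₂ : Finset (EuclideanSpace ℝ (Fin 3))) (R₀ h ρ : ℝ) (hR₀ : 3 ≤ R₀) (hρ : R₀ ≤ ρ) (hρ20 : 20 ≤ ρ)
    (hh : 0 ≤ h) (hP₁X : P₁ ⊆ X) (hP₂X : P₂ ⊆ X) (hcell : ∀ p ∈ X, p 2 ≤ h + 2 * R₀)
    (hP₁ : ∀ p, p ∈ P₁ ↔ (p ∈ (fun q => A₁ q + t₁) '' fccStacking 1 (Real.sqrt (2 / 3)) ∧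
      -(2 * R₀) ≤ p 2 ∧ p 2 ≤ -R₀ ∧ p 0 ^ 2 + p 1 ^ 2 ≤ ρ ^ 2))
    (hP₂ : ∀ p, p ∈ P₂ ↔ (p ∈ (fun q => A₂ q + t₂) '' fccStacking 1 (Real.sqrt (2 / 3)) ∧
      h + R₀ ≤ p 2 ∧ p 2 ≤ h + 2 * R₀ ∧ p 0 ^ 2 + p 1 ^ 2 ≤ ρ ^ 2))
    (𝓣 : Set (EuclideanSpace ℝ (Fin 3) ≃ₗᵢ[ℝ] EuclideanSpace ℝ (Fin 3))) (hA₁ : A₁ ∉ 𝓣)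
    (hT : ∀ G : EuclideanSpace ℝ (Fin 3) ≃ₗᵢ[ℝ] EuclideanSpace ℝ (Fin 3),
      G '' fccStacking 1 (Real.sqrt (2 / 3)) = A₂ '' fccStacking 1 (Real.sqrt (2 / 3)) → G ∈ 𝓣)
    (p0 p1 : ℝ) (hp : p0 ^ 2 + p1 ^ 2 ≤ (ρ - 20) ^ 2) :
    (∃ z ∈ X, (X.filter fun q => dist z q = 1).card ≤ 11 ∧ (z 0 - p0) ^ 2 + (z 1 - p1) ^ 2 ≤ 18 ^ 2 ∧
      -R₀ - 2 ≤ z 2 ∧ z 2 ≤ h + R₀ + 3) ∨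
    (∃ e ∈ X, ∃ G : EuclideanSpace ℝ (Fin 3) ≃ₗᵢ[ℝ] EuclideanSpace ℝ (Fin 3), G ∉ 𝓣 ∧
      ∃ n : EuclideanSpace ℝ (Fin 3), ‖n‖ = 1 ∧
      (∀ w ∈ fccSlots, ⟪G w, n⟫_ℝ = 0 ∨ ⟪G w, n⟫_ℝ = Real.sqrt (2 / 3) ∨ ⟪G w, n⟫_ℝ = -Real.sqrt (2 / 3)) ∧
      (∃ G' ∈ 𝓣, ∀ x, G' x = G x - (2 * ⟪G x, n⟫_ℝ) • n) ∧
      (∀ w ∈ fccSlots, ⟪G w, n⟫_ℝ ≤ 0 → e + G w ∈ X) ∧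
      (∀ w ∈ fccSlots, 0 < ⟪G w, n⟫_ℝ → e + G w ∉ X) ∧
      (e 0 - p0) ^ 2 + (e 1 - p1) ^ 2 ≤ 17 ^ 2 ∧ -R₀ - 1 ≤ e 2 ∧ e 2 < h + R₀ + 2) := by
  set Λ₁ : Set (EuclideanSpace ℝ (Fin 3)) := (fun q => A₁ q + t₁) '' fccStacking 1 (Real.sqrt (2 / 3)) with hΛ₁
  set e₃ : EuclideanSpace ℝ (Fin 3) := EuclideanSpace.single (2 : Fin 3) (1 : ℝ) with he₃
  have he₃i : ∀ d : EuclideanSpace ℝ (Fin 3), ⟪d, e₃⟫_ℝ = d 2 := fun d => by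
    rw [he₃, EuclideanSpace.inner_single_right]; simp
  have he₃0 : e₃ ≠ 0 := by
    intro h0
    have : ‖e₃‖ = 1 := by rw [he₃, PiLp.norm_single, norm_one]
    rw [h0, norm_zero] at this; norm_num at this
  -- the axis point at height `−R₀`
  set qpt : EuclideanSpace ℝ (Fin 3) := EuclideanSpace.single (0 : Fin 3) p0 + EuclideanSpace.single (1 : Fin 3) p1 +
    EuclideanSpace.single (2 : Fin 3) (-R₀) with hqpt
  have hq0 : qpt 0 = p0 := by simp [hqpt]
  have hq1 : qpt 1 = p1 := by simp [hqpt]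
  have hq2 : qpt 2 = -R₀ := by simp [hqpt]
  -- a start ball of `Λ₁` within distance `< 1` of it and not higher
  obtain ⟨x₀, hx₀Λ, hdx, hx₀2⟩ : ∃ x₀ ∈ Λ₁, dist qpt x₀ < 1 ∧ x₀ 2 ≤ -R₀ := by
    by_cases hq : qpt ∈ Λ₁
    · exact ⟨qpt, hq, by rw [dist_self]; norm_num, by rw [hq2]⟩
    · obtain ⟨v, hv, hd, hl⟩ := movedFcc_exists_near_below A₁ t₁ qpt hq
      exact ⟨v, hv, hd, by rw [hq2] at hl; exact hl⟩
  -- coordinates of `x₀` relative to the axis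
  have hcoord : ∀ i : Fin 3, |x₀ i - qpt i| ≤ dist qpt x₀ := fun i => by
    rw [dist_comm]; exact abs_apply_sub_le_dist x₀ qpt i
  have hx₀2' : -R₀ - 1 < x₀ 2 := by
    have := (abs_le.1 (hcoord 2)).1; rw [hq2] at this; linarith
  have hx₀h : (x₀ 0 - p0) ^ 2 + (x₀ 1 - p1) ^ 2 ≤ 1 ^ 2 := by
    have hn := norm_sq_eq_fin3 (x₀ - qpt)
    have hd1 : ‖x₀ - qpt‖ ^ 2 ≤ 1 := by
      rw [← dist_eq_norm, dist_comm]; nlinarith [dist_nonneg (x := qpt) (y := x₀)]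
    simp only [PiLp.sub_apply, hq0, hq1] at hn
    nlinarith [sq_nonneg ((x₀ - qpt) 2)]
  -- window membership of points of `Λ₁` near the axis at the right heights
  have hρ1 : (0 : ℝ) ≤ ρ - 20 := by linarith
  have inP₁ : ∀ v ∈ Λ₁, -(2 * R₀) ≤ v 2 → v 2 ≤ -R₀ → (v 0 - p0) ^ 2 + (v 1 - p1) ^ 2 ≤ 2 ^ 2 → v ∈ X := by
    intro v hv h1 h2 h3
    apply hP₁X
    rw [hP₁]
    refine ⟨hv, h1, h2, ?_⟩
    have := sq2_add_le hρ1 (by norm_num : (0 : ℝ) ≤ 2) hp h3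
    have e0 : v 0 = p0 + (v 0 - p0) := by ring
    have e1 : v 1 = p1 + (v 1 - p1) := by ring
    rw [e0, e1]; nlinarith
  have hx₀X : x₀ ∈ X := inP₁ x₀ hx₀Λ (by linarith) hx₀2 (by linarith)
  -- three independent down slots, all window balls
  obtain ⟨a, ha, b, hb, c, hc', ha', hb', hc'', hind⟩ := exists_independent_slots_of_hemisphere A₁ he₃0
  have down : ∀ {w}, w ∈ fccSlots → ⟪A₁ w, e₃⟫_ℝ < 0 → x₀ + A₁ w ∈ X := by
    intro w hw hneg
    rw [he₃i] at hneg
    have hw1 : ‖A₁ w‖ = 1 := by rw [LinearIsometryEquiv.norm_map, norm_eq_one_of_mem_fccSlots hw]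
    have hwn := norm_sq_eq_fin3 (A₁ w)
    rw [hw1, one_pow] at hwn
    have hw2 : -1 ≤ (A₁ w) 2 := by nlinarith [sq_nonneg ((A₁ w) 0), sq_nonneg ((A₁ w) 1), sq_nonneg ((A₁ w) 2 + 1)]
    have hwh : (A₁ w) 0 ^ 2 + (A₁ w) 1 ^ 2 ≤ 1 ^ 2 := by nlinarith [sq_nonneg ((A₁ w) 2)]
    apply inP₁ _ (movedFcc_add_site_mem A₁ t₁ hx₀Λ (mem_fcc_of_mem_fccSlots hw))
    · simp only [PiLp.add_apply]; linarith
    · simp only [PiLp.add_apply]; linarith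
    · have := sq2_add_le (by norm_num : (0 : ℝ) ≤ 1) (by norm_num : (0 : ℝ) ≤ 1) hx₀h hwh
      simp only [PiLp.add_apply]
      have e0 : x₀ 0 + (A₁ w) 0 - p0 = (x₀ 0 - p0) + (A₁ w) 0 := by ring
      have e1 : x₀ 1 + (A₁ w) 1 - p1 = (x₀ 1 - p1) + (A₁ w) 1 := by ring
      rw [e0, e1]; linarith
  -- run the walk
  rcases tube_walk_chain_sf hg hc X hX A₂ t₂ P₂ R₀ h ρ hR₀ hρ hρ20 hP₂X hcell hP₂ 𝓣 hT p0 p1 hp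
      ⌈(h + 3 * R₀ + 3) * 32⌉₊ x₀ A₁ a b c hx₀X hA₁ ha hb hc' hind
      (down ha ha') (down hb hb') (down hc' hc'') (by linarith) (by linarith)
      (by
        have h1 : (h + 2 * R₀ + 2 - x₀ 2) * 32 ≤ (h + 3 * R₀ + 3) * 32 := by nlinarith
        exact h1.trans (Nat.le_ceil _)) with
    ⟨z, hz, hdeg, hzh, hz1, hz2⟩ | ⟨e, he, G, hG, n, hn, hmenu, hG', hown, hfar, her, he1, he2⟩
  · exact Or.inl ⟨z, hz, hdeg, hzh, by linarith, hz2⟩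
  · exact Or.inr ⟨e, he, G, hG, n, hn, hmenu, hG', hown, hfar, her, by linarith, he2⟩

end Summit.Ventures.Crystal3D.Theorems

end
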